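import Summits.ResolutionOfSingularities.ResolutionOfSingularities.Theorems.FrobeniusLadderFInjectiveMacaulayficationCIChartCore
import Summits.ResolutionOfSingularities.ResolutionOfSingularities.Theorems.FrobeniusLadderFInjectiveMacaulayficationCIFedderAtMaximalIdeal
import Summits.ResolutionOfSingularities.ResolutionOfSingularities.Theorems.FrobeniusLadderFInjectiveMacaulayficationHypersurfaceRegular
import Summits.ResolutionOfSingularities.ResolutionOfSingularities.Theorems.FrobeniusLadderFInjectiveMacaulayficationRegularExceptionalSlices
import Summits.ResolutionOfSingularities.ResolutionOfSingularities.Theorems.FrobeniusLadderFInjectiveMacaulayficationFiLocusOpenOfAffine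
import Summits.ResolutionOfSingularities.ResolutionOfSingularities.Theorems.FrobeniusLadderFInjectiveMacaulayficationSliceableCentre
import Literature.AlgebraicGeometry.Resolution.MvPolynomialKillVars
import Literature.AlgebraicGeometry.Resolution.RegularLocalRingsQuotient
import Mathlib.RingTheory.Polynomial.Eisenstein.Criterion
import Mathlib.RingTheory.Polynomial.UniqueFactorization
import Mathlib.Algebra.MvPolynomial.Equiv
import Mathlib.Algebra.MvPolynomial.PDeriv
import Mathlib.Algebra.MvPolynomial.Division
import Mathlib.Algebra.Polynomial.Degree.SmallDegree
import Mathlib.RingTheory.KrullDimension.Basic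
import HarnessLib

/-!
# The wild-pinch CYLINDER `W × 𝔸²`: `k[u,t,y,v₁,v₂]/(y² + u²ty + ut²)` — primality, a chain of primes, dimension ≥ 4,
# Cohen–Macaulay clause at every prime, regular (hence FULL) away from `t = 0`
# (crux `FInjectiveMacaulayfication` stmt-ResolutionOfSingularities-15315, chain w45a; res-L1-w45a-plan-1 R16.29 (3)(b): the WITNESS side of the
# conditional negative `RelClosedSubsetFixPow` ✗, res-L1-w45a-tri-2 KILL-T3POW 21:10:06Z)

[OURS · L1 W4.5a · res-L1-w45a-stub-3] Support file (`--supports stmt-ResolutionOfSingularities-15315 --as helper`), theorem-only, for the crux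
`FrobeniusLadder.FInjectiveMacaulayfication`; NOT a statement of any manuscript; replaces the role of NOTHING in H. Hironaka's manuscript;
AI-written, weaker than expert review. The polynomial `F = X₂² + X₀² X₁ X₂ + X₀ X₁²` (`u = X₀`, `t = X₁`, `y = X₂`, `v₁ = X₃`, `v₂ = X₄`) is
res-L1-w45a-strat-1's wild pinch `WildPinchCert.F` in five variables = the cylinder `W × 𝔸²` over a field `k`; everything is stated with
`(F) (hF : F = …)` binders (no definition is introduced).

* §1 `prime_F` — `F` is prime over EVERY field: Eisenstein at the prime `u` in `k[u,t,v₁,v₂][y]` (monic in `y`, lower coefficients `u²t`,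
  `ut²` divisible by `u`, constant `ut² ∉ (u²)`); `F_not_dvd_X` — `F` divides no variable.
* §2 the primes `𝔮_S = (X_i : i ∈ S)·R` of `R = k[X₀…X₄]/(F)` for `S ⊇ {0, 2}` (`F ∈ (X₀, X₂)`), the chain
  `⊥ < 𝔮_{02} < 𝔮_{012} < 𝔮_{0123} < 𝔮_{01234}` and `4 ≤ ringKrullDim R`.
* §3 `cmClause_localization` — every local ring `R_Q` satisfies the CM clause (hypersurface in the regular `k[X]_P`).
* §4 `isRegularLocalRing_of_X1_not_mem`, `fullCl_localization_of_X1_not_mem` — in characteristic 2, `∂F/∂u = t²`, so `R_Q` is regular, hence FULL,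
  at every prime `Q ∌ t`.
[folklore computations; cite: Matsumura1987, Thm. 17.4, Thm. 30.4]
-/

-- single-problem summit: the doubled namespace component is forced
set_option linter.dupNamespace false

noncomputable section

open MvPolynomial IsLocalRing Literature.AlgebraicGeometry.Resolution

namespace Summit.ResolutionOfSingularities.ResolutionOfSingularities.Theorems.FInjectiveMacaulayfication.WildPinchCylinder

open Summit.ResolutionOfSingularities.ResolutionOfSingularities.Theorems.FInjectiveMacaulayfication
open Summit.ResolutionOfSingularities.ResolutionOfSingularities.Theorems.FInjectiveMacaulayfication.SliceableCentre (CMCl FCl FullCl)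

variable (k : Type) [Field k]

/-! ## §1 `F` is prime -/

section Eisenstein

variable {B : Type} [CommRing B] [IsDomain B] (u t : B)

/-- `y² + (u² t) y + u t²` is monic of degree `2`. [folklore] -/
theorem monic_natDegree_quadratic :
    (Polynomial.X ^ 2 + Polynomial.C (u ^ 2 * t) * Polynomial.X + Polynomial.C (u * t ^ 2) : Polynomial B).Monic ∧
      (Polynomial.X ^ 2 + Polynomial.C (u ^ 2 * t) * Polynomial.X + Polynomial.C (u * t ^ 2) : Polynomial B).natDegree = 2 := by
  have hlin : (Polynomial.C (u ^ 2 * t) * Polynomial.X + Polynomial.C (u * t ^ 2)).degree <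
      (Polynomial.X ^ 2 : Polynomial B).degree := by
    rw [Polynomial.degree_X_pow]
    exact lt_of_le_of_lt Polynomial.degree_linear_le (by exact_mod_cast (show (1 : ℕ) < 2 by norm_num))
  rw [add_assoc]
  exact ⟨(Polynomial.monic_X_pow 2).add_of_left hlin,
    by rw [Polynomial.natDegree_add_eq_left_of_degree_lt hlin, Polynomial.natDegree_X_pow]⟩

/-- **Eisenstein**: `y² + (u² t) y + u t²` is irreducible over a domain `B` in which `u` is prime and `u ∤ t²`. [folklore] -/
theorem irreducible_quadratic_eisenstein (hu : Prime u) (hut : ¬ u ∣ t ^ 2) :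
    Irreducible (Polynomial.X ^ 2 + Polynomial.C (u ^ 2 * t) * Polynomial.X + Polynomial.C (u * t ^ 2) : Polynomial B) := by
  obtain ⟨hmonic, hnat⟩ := monic_natDegree_quadratic u t
  set f : Polynomial B := Polynomial.X ^ 2 + Polynomial.C (u ^ 2 * t) * Polynomial.X + Polynomial.C (u * t ^ 2) with hf
  have hdeg : f.degree = (2 : ℕ) := by rw [Polynomial.degree_eq_natDegree hmonic.ne_zero, hnat]
  have hP : (Ideal.span {u}).IsPrime := (Ideal.span_singleton_prime hu.ne_zero).mpr hu
  have hc0 : f.coeff 0 = u * t ^ 2 := by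
    rw [hf]
    simp only [Polynomial.coeff_add, Polynomial.coeff_C_mul, Polynomial.coeff_X_pow, Polynomial.coeff_X,
      Polynomial.coeff_C]
    norm_num
  have hc1 : f.coeff 1 = u ^ 2 * t := by
    rw [hf]
    simp only [Polynomial.coeff_add, Polynomial.coeff_C_mul, Polynomial.coeff_X_pow, Polynomial.coeff_X,
      Polynomial.coeff_C]
    norm_num
  refine Polynomial.irreducible_of_eisenstein_criterion hP ?_ ?_ ?_ ?_ hmonic.isPrimitive
  · rw [hmonic.leadingCoeff]
    exact fun h => hP.ne_top ((Ideal.eq_top_iff_one _).mpr h)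
  · intro n hn
    rw [hdeg] at hn
    have hn2 : n < 2 := by exact_mod_cast hn
    interval_cases n
    · rw [hc0]
      exact Ideal.mem_span_singleton.mpr ⟨t ^ 2, rfl⟩
    · rw [hc1]
      exact Ideal.mem_span_singleton.mpr ⟨u * t, by ring⟩
  · rw [hdeg]
    exact_mod_cast Nat.succ_pos 1
  · rw [Ideal.span_singleton_pow, hc0]
    intro h
    obtain ⟨c, hc⟩ := Ideal.mem_span_singleton.mp h
    apply hut
    refine ⟨c, mul_left_cancel₀ hu.ne_zero ?_⟩
    rw [hc]
    ring

end Eisenstein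

/-- **`F = X₂² + X₀²X₁X₂ + X₀X₁²` is prime over every field, and divides no variable.** Identify `k[X₀,…,X₄]` with `k[Y₀,…,Y₃][T]`
(`X₂ ↦ T`, `X₀ ↦ C Y₁`, `X₁ ↦ C Y₀`, `X₃ ↦ C Y₂`, `X₄ ↦ C Y₃`): `F ↦ T² + (Y₁² Y₀) T + Y₁ Y₀²`, Eisenstein at the prime `Y₁`. [folklore] -/
theorem prime_F (F : MvPolynomial (Fin 5) k) (hF : F = X 2 ^ 2 + X 0 ^ 2 * X 1 * X 2 + X 0 * X 1 ^ 2) :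
    Prime F ∧ ∀ v : Fin 5, ¬ F ∣ MvPolynomial.X v := by
  obtain ⟨e, he0, he1, he2, hdeg⟩ : ∃ e : MvPolynomial (Fin 5) k ≃+* Polynomial (MvPolynomial (Fin 4) k),
      e (X 0) = Polynomial.C (X 1) ∧ e (X 1) = Polynomial.C (X 0) ∧ e (X 2) = Polynomial.X ∧
        ∀ v : Fin 5, (e (X v)).natDegree ≤ 1 := by
    refine ⟨((renameEquiv k (Equiv.swap (0 : Fin 5) 2)).trans (finSuccEquiv k 4)).toRingEquiv, ?_, ?_, ?_, ?_⟩
    · show finSuccEquiv k 4 (rename (Equiv.swap (0 : Fin 5) 2) (X 0)) = _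
      rw [rename_X, Equiv.swap_apply_left]
      exact finSuccEquiv_X_succ (j := 1)
    · show finSuccEquiv k 4 (rename (Equiv.swap (0 : Fin 5) 2) (X 1)) = _
      rw [rename_X, Equiv.swap_apply_of_ne_of_ne (by decide) (by decide)]
      exact finSuccEquiv_X_succ (j := 0)
    · show finSuccEquiv k 4 (rename (Equiv.swap (0 : Fin 5) 2) (X 2)) = _
      rw [rename_X, Equiv.swap_apply_right]
      exact finSuccEquiv_X_zero
    · intro v
      show (finSuccEquiv k 4 (rename (Equiv.swap (0 : Fin 5) 2) (X v))).natDegree ≤ 1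
      classical
      rw [rename_X, MvPolynomial.natDegree_finSuccEquiv, degreeOf_X]
      split_ifs <;> simp
  have heF : e F = Polynomial.X ^ 2 + Polynomial.C ((X 1 : MvPolynomial (Fin 4) k) ^ 2 * X 0) * Polynomial.X +
      Polynomial.C ((X 1 : MvPolynomial (Fin 4) k) * X 0 ^ 2) := by
    subst hF
    simp only [map_add, map_mul, map_pow, he0, he1, he2]
  have hut : ¬ (X 1 : MvPolynomial (Fin 4) k) ∣ X 0 ^ 2 := fun h => by
    have h1 : (X 1 : MvPolynomial (Fin 4) k) ∣ X 0 := MvPolynomial.X_prime.dvd_of_dvd_pow h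
    exact absurd (MvPolynomial.X_dvd_X.mp h1) (by decide)
  have hirr : Irreducible (e F) := by
    rw [heF]
    exact irreducible_quadratic_eisenstein (X 1) (X 0) MvPolynomial.X_prime hut
  have hnat : (e F).natDegree = 2 := by
    rw [heF]
    exact (monic_natDegree_quadratic (X 1 : MvPolynomial (Fin 4) k) (X 0)).2
  have hprime : Prime F := (MulEquiv.prime_iff e).mp hirr.prime
  refine ⟨hprime, fun v hv => ?_⟩
  -- a divisor of `X v` would have `e`-image of degree ≤ 1
  obtain ⟨q, hq⟩ := hv
  have hd : e F ∣ e (X v) := ⟨e q, by rw [← map_mul, ← hq]⟩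
  have hne : e (X v) ≠ 0 := fun h0 => MvPolynomial.X_ne_zero v (e.injective (h0.trans (map_zero e).symm))
  have hle := (Polynomial.natDegree_le_of_dvd hd hne).trans (hdeg v)
  omega

/-- `(F)` is a prime ideal of `k[X₀,…,X₄]`. [folklore] -/
theorem span_F_isPrime (F : MvPolynomial (Fin 5) k) (hF : F = X 2 ^ 2 + X 0 ^ 2 * X 1 * X 2 + X 0 * X 1 ^ 2) :
    (Ideal.span {F}).IsPrime :=
  (Ideal.span_singleton_prime (prime_F k F hF).1.ne_zero).mpr (prime_F k F hF).1

/-- `R = k[X]/(F)` is a domain. [folklore] -/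
theorem isDomain_quotient (F : MvPolynomial (Fin 5) k) (hF : F = X 2 ^ 2 + X 0 ^ 2 * X 1 * X 2 + X 0 * X 1 ^ 2) :
    IsDomain (MvPolynomial (Fin 5) k ⧸ Ideal.span {F}) :=
  haveI := span_F_isPrime k F hF
  Ideal.Quotient.isDomain _

/-- No variable dies in `R = k[X]/(F)`. [folklore] -/
theorem mk_X_ne_zero (F : MvPolynomial (Fin 5) k) (hF : F = X 2 ^ 2 + X 0 ^ 2 * X 1 * X 2 + X 0 * X 1 ^ 2) (v : Fin 5) :
    Ideal.Quotient.mk (Ideal.span {F}) (MvPolynomial.X v) ≠ 0 := fun h0 =>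
  (prime_F k F hF).2 v (Ideal.mem_span_singleton.mp (Ideal.Quotient.eq_zero_iff_mem.mp h0))


/-! ## §2 A chain of primes through `F` and `4 ≤ dim R` -/

section Primes

variable (F : MvPolynomial (Fin 5) k) (hF : F = X 2 ^ 2 + X 0 ^ 2 * X 1 * X 2 + X 0 * X 1 ^ 2)

include hF in
/-- `F ∈ (X_i : i ∈ S)` whenever `0, 2 ∈ S` (`F = X₂·(X₂ + X₀²X₁) + X₀·X₁²`). [folklore] -/
theorem F_mem_span_X {S : Set (Fin 5)} (h0 : (0 : Fin 5) ∈ S) (h2 : (2 : Fin 5) ∈ S) :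
    F ∈ Ideal.span (MvPolynomial.X '' S : Set (MvPolynomial (Fin 5) k)) := by
  have hX0 : (X 0 : MvPolynomial (Fin 5) k) ∈ Ideal.span (MvPolynomial.X '' S : Set (MvPolynomial (Fin 5) k)) :=
    Ideal.subset_span ⟨0, h0, rfl⟩
  have hX2 : (X 2 : MvPolynomial (Fin 5) k) ∈ Ideal.span (MvPolynomial.X '' S : Set (MvPolynomial (Fin 5) k)) :=
    Ideal.subset_span ⟨2, h2, rfl⟩
  have e : F = X 2 * (X 2 + X 0 ^ 2 * X 1) + X 0 * X 1 ^ 2 := by rw [hF]; ring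
  rw [e]
  exact Ideal.add_mem _ (Ideal.mul_mem_right _ _ hX2) (Ideal.mul_mem_right _ _ hX0)

include hF in
/-- For `0, 2 ∈ S` the image `𝔮_S` of `(X_i : i ∈ S)` in `R = k[X]/(F)` is a prime ideal pulling back to `(X_i : i ∈ S)`. [folklore] -/
theorem isPrime_map_span_X {S : Set (Fin 5)} (h0 : (0 : Fin 5) ∈ S) (h2 : (2 : Fin 5) ∈ S) :
    ((Ideal.span (MvPolynomial.X '' S : Set (MvPolynomial (Fin 5) k))).map (Ideal.Quotient.mk (Ideal.span {F}))).IsPrime ∧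
      ((Ideal.span (MvPolynomial.X '' S : Set (MvPolynomial (Fin 5) k))).map (Ideal.Quotient.mk (Ideal.span {F}))).comap
        (Ideal.Quotient.mk (Ideal.span {F})) = Ideal.span (MvPolynomial.X '' S : Set (MvPolynomial (Fin 5) k)) := by
  have hker : RingHom.ker (Ideal.Quotient.mk (Ideal.span {F})) ≤ Ideal.span (MvPolynomial.X '' S : Set (MvPolynomial (Fin 5) k)) := by
    rw [Ideal.mk_ker, Ideal.span_le, Set.singleton_subset_iff]
    exact F_mem_span_X k F hF h0 h2
  haveI : (Ideal.span (MvPolynomial.X '' S : Set (MvPolynomial (Fin 5) k))).IsPrime := by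
    haveI := Literature.AlgebraicGeometry.Resolution.MvPolynomial.isDomain_quotient_span_X (R := k) (τ := Fin 5) S
    exact (Ideal.Quotient.isDomain_iff_prime _).mp this
  refine ⟨Ideal.map_isPrime_of_surjective Ideal.Quotient.mk_surjective hker, ?_⟩
  rw [Ideal.comap_map_of_surjective _ Ideal.Quotient.mk_surjective, sup_eq_left]
  rwa [← RingHom.ker_eq_comap_bot]

include hF in
/-- Strictness: for `0, 2 ∈ S ⊆ T` and `j ∈ T ∖ S`, `𝔮_S < 𝔮_T`. [folklore] -/
theorem map_span_X_lt {S T : Set (Fin 5)} (h0 : (0 : Fin 5) ∈ S) (h2 : (2 : Fin 5) ∈ S) (hST : S ⊆ T) {j : Fin 5} (hjT : j ∈ T)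
    (hjS : j ∉ S) :
    (Ideal.span (MvPolynomial.X '' S : Set (MvPolynomial (Fin 5) k))).map (Ideal.Quotient.mk (Ideal.span {F})) <
      (Ideal.span (MvPolynomial.X '' T : Set (MvPolynomial (Fin 5) k))).map (Ideal.Quotient.mk (Ideal.span {F})) := by
  refine lt_of_le_of_ne (Ideal.map_mono (Ideal.span_mono (Set.image_mono hST))) fun heq => ?_
  have hj : Ideal.Quotient.mk (Ideal.span {F}) (X j) ∈
      (Ideal.span (MvPolynomial.X '' S : Set (MvPolynomial (Fin 5) k))).map (Ideal.Quotient.mk (Ideal.span {F})) := by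
    rw [heq]
    exact Ideal.mem_map_of_mem _ (Ideal.subset_span ⟨j, hjT, rfl⟩)
  have hj' : (X j : MvPolynomial (Fin 5) k) ∈ Ideal.span (MvPolynomial.X '' S : Set (MvPolynomial (Fin 5) k)) := by
    rw [← (isPrime_map_span_X k F hF h0 h2).2]
    exact Ideal.mem_comap.mpr hj
  exact Literature.AlgebraicGeometry.Resolution.MvPolynomial.X_not_mem_span_X (R := k) S hjS hj'

include hF in
/-- **`4 ≤ dim k[X₀,…,X₄]/(F)`**: the chain `⊥ < 𝔮_{02} < 𝔮_{012} < 𝔮_{0123} < 𝔮_{01234}` of primes. [folklore] -/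
theorem four_le_ringKrullDim : (4 : WithBot ℕ∞) ≤ ringKrullDim (MvPolynomial (Fin 5) k ⧸ Ideal.span {F}) := by
  haveI := isDomain_quotient k F hF
  -- the primes
  let 𝔮 : Set (Fin 5) → Ideal (MvPolynomial (Fin 5) k ⧸ Ideal.span {F}) := fun S =>
    (Ideal.span (MvPolynomial.X '' S : Set (MvPolynomial (Fin 5) k))).map (Ideal.Quotient.mk (Ideal.span {F}))
  have hP : ∀ S : Set (Fin 5), (0 : Fin 5) ∈ S → (2 : Fin 5) ∈ S → (𝔮 S).IsPrime := fun S h0 h2 =>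
    (isPrime_map_span_X k F hF h0 h2).1
  let S₁ : Set (Fin 5) := {0, 2}
  let S₂ : Set (Fin 5) := {0, 1, 2}
  let S₃ : Set (Fin 5) := {0, 1, 2, 3}
  let S₄ : Set (Fin 5) := {0, 1, 2, 3, 4}
  let p₀ : PrimeSpectrum (MvPolynomial (Fin 5) k ⧸ Ideal.span {F}) := ⟨⊥, Ideal.isPrime_bot⟩
  let p₁ : PrimeSpectrum (MvPolynomial (Fin 5) k ⧸ Ideal.span {F}) := ⟨𝔮 S₁, hP S₁ (by simp [S₁]) (by simp [S₁])⟩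
  let p₂ : PrimeSpectrum (MvPolynomial (Fin 5) k ⧸ Ideal.span {F}) := ⟨𝔮 S₂, hP S₂ (by simp [S₂]) (by simp [S₂])⟩
  let p₃ : PrimeSpectrum (MvPolynomial (Fin 5) k ⧸ Ideal.span {F}) := ⟨𝔮 S₃, hP S₃ (by simp [S₃]) (by simp [S₃])⟩
  let p₄ : PrimeSpectrum (MvPolynomial (Fin 5) k ⧸ Ideal.span {F}) := ⟨𝔮 S₄, hP S₄ (by simp [S₄]) (by simp [S₄])⟩
  have h₀₁ : p₀ < p₁ := by
    rw [← PrimeSpectrum.asIdeal_lt_asIdeal]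
    refine bot_lt_iff_ne_bot.mpr fun h => mk_X_ne_zero k F hF 0 ?_
    have hx : Ideal.Quotient.mk (Ideal.span {F}) (X 0) ∈ 𝔮 S₁ := Ideal.mem_map_of_mem _ (Ideal.subset_span ⟨0, by simp [S₁], rfl⟩)
    rw [show 𝔮 S₁ = p₁.asIdeal from rfl, h] at hx
    exact (Ideal.mem_bot.mp hx)
  have h₁₂ : p₁ < p₂ := by
    rw [← PrimeSpectrum.asIdeal_lt_asIdeal]
    exact map_span_X_lt k F hF (S := S₁) (T := S₂) (by simp [S₁]) (by simp [S₁]) (by intro i hi; simp only [S₁, Set.mem_insert_iff, Set.mem_singleton_iff] at hi; simp only [S₂, Set.mem_insert_iff, Set.mem_singleton_iff]; tauto)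
      (j := 1) (by simp [S₂]) (by simp [S₁])
  have h₂₃ : p₂ < p₃ := by
    rw [← PrimeSpectrum.asIdeal_lt_asIdeal]
    exact map_span_X_lt k F hF (S := S₂) (T := S₃) (by simp [S₂]) (by simp [S₂]) (by intro i hi; simp only [S₂, Set.mem_insert_iff, Set.mem_singleton_iff] at hi; simp only [S₃, Set.mem_insert_iff, Set.mem_singleton_iff]; tauto)
      (j := 3) (by simp [S₃]) (by simp [S₂])
  have h₃₄ : p₃ < p₄ := by
    rw [← PrimeSpectrum.asIdeal_lt_asIdeal]
    exact map_span_X_lt k F hF (S := S₃) (T := S₄) (by simp [S₃]) (by simp [S₃]) (by intro i hi; simp only [S₃, Set.mem_insert_iff, Set.mem_singleton_iff] at hi; simp only [S₄, Set.mem_insert_iff, Set.mem_singleton_iff]; tauto)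
      (j := 4) (by simp [S₄]) (by simp [S₃])
  -- the series
  let l : LTSeries (PrimeSpectrum (MvPolynomial (Fin 5) k ⧸ Ideal.span {F})) :=
    ((((RelSeries.singleton _ p₀).snoc p₁ h₀₁).snoc p₂ (by simpa using h₁₂)).snoc p₃ (by simpa using h₂₃)).snoc p₄
      (by simpa using h₃₄)
  have hl : l.length = 4 := by simp [l]
  calc (4 : WithBot ℕ∞) = (l.length : WithBot ℕ∞) := by rw [hl]; rfl
    _ ≤ ringKrullDim (MvPolynomial (Fin 5) k ⧸ Ideal.span {F}) := Order.LTSeries.length_le_krullDim l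

end Primes

/-! ## §3 The Cohen–Macaulay clause at every prime (hypersurface in a regular local ring) -/

/-- **Every local ring of the hypersurface `R = k[X]/(F)` satisfies the CM clause**: `R_Q ≅ k[X]_P/(F)` with `k[X]_P` regular local and
`F ≠ 0` in its maximal ideal (`CIChartCore.sop_isWeaklyRegular_quotient_ofList`). No characteristic hypothesis. [cite: Matsumura1987, Thm. 17.4] -/
theorem cmClause_localization (F : MvPolynomial (Fin 5) k) (hF : F = X 2 ^ 2 + X 0 ^ 2 * X 1 * X 2 + X 0 * X 1 ^ 2)
    (Q : Ideal (MvPolynomial (Fin 5) k ⧸ Ideal.span {F})) [Q.IsPrime] : CMCl (Localization.AtPrime Q) := by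
  haveI hPr : (Q.comap (Ideal.Quotient.mk (Ideal.span {F}))).IsPrime := Ideal.comap_isPrime _ _
  set P : Ideal (MvPolynomial (Fin 5) k) := Q.comap (Ideal.Quotient.mk (Ideal.span {F})) with hP_def
  set S := Localization.AtPrime P
  haveI : IsRegularLocalRing S := IsRegularRing.isRegularLocalRing_localization P
  have hFP : F ∈ P := by
    rw [hP_def, Ideal.mem_comap, Ideal.Quotient.eq_zero_iff_mem.mpr (Ideal.mem_span_singleton_self F)]
    exact Q.zero_mem
  set g : S := algebraMap (MvPolynomial (Fin 5) k) S F with hg_def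
  have hgm : g ∈ maximalIdeal S := by
    rw [← IsLocalization.AtPrime.map_eq_maximalIdeal P S]
    exact Ideal.mem_map_of_mem _ hFP
  have hg0 : g ≠ 0 := by
    intro h
    have hinj : Function.Injective (algebraMap (MvPolynomial (Fin 5) k) S) :=
      IsLocalization.injective S P.primeCompl_le_nonZeroDivisors
    exact (prime_F k F hF).1.ne_zero (hinj (h.trans (map_zero _).symm))
  -- `S ⧸ (g) ≅ R_Q`
  have hspan : Ideal.span {g} = Ideal.ofList [g] := by
    show Ideal.span {g} = Ideal.span {r | r ∈ [g]}
    simp only [List.mem_singleton, Set.setOf_eq_eq_singleton]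
  have hofList : Ideal.ofList [g] = (Ideal.span {F}).map (algebraMap (MvPolynomial (Fin 5) k) S) := by
    rw [← hspan, Ideal.map_span, Set.image_singleton]
  obtain ⟨e₀⟩ := CIFedderAtMaximalIdeal.nonempty_quotLocalizationEquiv (MvPolynomial (Fin 5) k) (Ideal.span {F}) Q
  have e₁ : (S ⧸ Ideal.ofList [g]) ≃+* Localization.AtPrime Q := (Ideal.quotEquivOfEq hofList).trans e₀
  -- dimension bookkeeping
  obtain ⟨e, he⟩ := exists_nat_cast_eq_ringKrullDim (R := Localization.AtPrime Q)
  have hquot : ringKrullDim (S ⧸ Ideal.ofList [g]) = (e : WithBot ℕ∞) := by rw [ringKrullDim_eq_of_ringEquiv e₁, he]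
  have hsucc := ringKrullDim_quotient_span_singleton_succ_eq_ringKrullDim_of_mem_nonZeroDivisors
    (mem_nonZeroDivisors_of_ne_zero hg0) hgm
  rw [hspan, hquot] at hsucc
  have hdim : ringKrullDim S = (([g].length + e : ℕ) : WithBot ℕ∞) := by
    rw [← hsucc, List.length_singleton, Nat.cast_add, Nat.cast_one, add_comm]
  exact FiLocusOpenOfAffine.cmClause_of_ringEquiv e₁
    (CIChartCore.sop_isWeaklyRegular_quotient_ofList [g] (fun x hx => by rw [List.mem_singleton.mp hx]; exact hgm) e hdim hquot)

/-! ## §4 Regularity, hence FULL-ness, away from `t = 0` (characteristic 2) -/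

/-- `∂F/∂u = 2·u t y + t² = t²` in characteristic 2. [folklore] -/
theorem pderiv_zero_F [CharP k 2] (F : MvPolynomial (Fin 5) k) (hF : F = X 2 ^ 2 + X 0 ^ 2 * X 1 * X 2 + X 0 * X 1 ^ 2) :
    pderiv 0 F = X 1 ^ 2 := by
  have h2 : (2 : MvPolynomial (Fin 5) k) = 0 := by
    have h : (2 : k) = 0 := by exact_mod_cast CharP.cast_eq_zero k 2
    rw [← map_ofNat (C : k →+* MvPolynomial (Fin 5) k) 2, h, map_zero]
  subst hF
  simp only [map_add, pderiv_mul, pderiv_pow, pderiv_X_self,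
    pderiv_X_of_ne (show (1 : Fin 5) ≠ 0 by decide), pderiv_X_of_ne (show (2 : Fin 5) ≠ 0 by decide)]
  linear_combination (X 0 * X 1 * X 2 : MvPolynomial (Fin 5) k) * h2

/-- **`R_Q` is regular at every prime `Q ∌ t`** (Jacobian criterion, `HypersurfaceRegular.stub_hypersurfaceRegularOfPderiv` with `∂F/∂u = t²`).
[cite: Matsumura1987, Thm. 30.4] -/
theorem isRegularLocalRing_of_X1_not_mem [CharP k 2] (F : MvPolynomial (Fin 5) k)
    (hF : F = X 2 ^ 2 + X 0 ^ 2 * X 1 * X 2 + X 0 * X 1 ^ 2) (Q : Ideal (MvPolynomial (Fin 5) k ⧸ Ideal.span {F})) [Q.IsPrime]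
    (ht : Ideal.Quotient.mk (Ideal.span {F}) (X 1) ∉ Q) : IsRegularLocalRing (Localization.AtPrime Q) := by
  refine HypersurfaceRegular.stub_hypersurfaceRegularOfPderiv k 5 F 0 Q fun hd => ht ?_
  rw [pderiv_zero_F k F hF] at hd
  have hX1 : (X 1 : MvPolynomial (Fin 5) k) ∈ Q.comap (Ideal.Quotient.mk (Ideal.span {F})) :=
    (Ideal.comap_isPrime _ Q).mem_of_pow_mem 2 hd
  exact Ideal.mem_comap.mp hX1

/-- **`R_Q` is FULL at every prime `Q ∌ t`** (regular ⇒ domain + CM clause + F-clause, `p = 2`). [cite: Matsumura1987, Thm. 17.4; Fedder1983] -/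
theorem fullCl_localization_of_X1_not_mem [CharP k 2] (F : MvPolynomial (Fin 5) k)
    (hF : F = X 2 ^ 2 + X 0 ^ 2 * X 1 * X 2 + X 0 * X 1 ^ 2) (Q : Ideal (MvPolynomial (Fin 5) k ⧸ Ideal.span {F})) [Q.IsPrime]
    (ht : Ideal.Quotient.mk (Ideal.span {F}) (X 1) ∉ Q) : FullCl 2 (Localization.AtPrime Q) := by
  haveI := isRegularLocalRing_of_X1_not_mem k F hF Q ht
  haveI : CharP (Localization.AtPrime Q) 2 :=
    CharP.of_ringHom_of_ne_zero ((algebraMap (MvPolynomial (Fin 5) k ⧸ Ideal.span {F}) (Localization.AtPrime Q)).comp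
      ((Ideal.Quotient.mk (Ideal.span {F})).comp MvPolynomial.C)) 2 two_ne_zero
  haveI : IsDomain (Localization.AtPrime Q) := isDomain_of_isRegularLocalRing (Localization.AtPrime Q)
  obtain ⟨hCM, hF'⟩ := RegularExceptionalSlices.cmClause_and_fClause_of_isRegularLocalRing Nat.prime_two (Localization.AtPrime Q)
  exact ⟨inferInstance, fun d hd s hmax => ⟨hCM d hd s hmax, hF' d hd s hmax⟩⟩

end Summit.ResolutionOfSingularities.ResolutionOfSingularities.Theorems.FInjectiveMacaulayfication.WildPinchCylinder

end
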